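import Literature.Geometry.Lorentzian.CoordShrinkerIdentities
import Literature.Geometry.Lorentzian.CoordRicciEvolution
import Literature.Geometry.Lorentzian.CoordCurvatureLaplacian
import HarnessLib

/-!
# `Δ_f Ric = 2λ Ric − 2 Rm(Ric)` for gradient Ricci solitons, in coordinates

Continuation of `CoordShrinkerIdentities.lean` (metric components `G : E → (E →L E →L ℝ)`,
smooth, symmetric and nondegenerate on an open set `V`, `IsMetricOn G V`; a smooth `f : E → ℝ`
with the gradient Ricci soliton equation `Ric + Hess f = λ G` on `V`). With the rough Laplacian
`ΔRic = lapBilinAt G (ricAt G)` (`CoordRicciEvolution.lean`), the covariant derivatives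
`∇Ric = cov₂At G (ricAt G)`, `∇²Ric = cov₃At G (cov₂At G (ricAt G))`, the gradient `∇f = ♯Df` and
the quadratic curvature term `Rm(Ric)(Y,Z) = Σ_{ij} g^{ij} Ric(R(bᵢ,Y)Z, bⱼ)` we PROVE
**Hamilton's second-order identity for the Ricci tensor of a gradient soliton**

  `ΔRic(Y,Z) = (∇_{∇f} Ric)(Y,Z) + 2λ Ric(Y,Z) − 2 Σ g^{ij} Ric(R(bᵢ,Y)Z, bⱼ)`

(`IsMetricOn.lapBilinAt_ricAt_of_soliton`), i.e. `Δ_f Ric = 2λ Ric − 2 Rm(Ric)` — Munteanu–Wang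
2016, §2 (p. 6), third displayed identity "`Δ_f Ric = Ric − 2 Rm Ric`" (`λ = ½`);
Eminenti–La Nave–Mantegazza 2008, Prop. 2.1; Petersen–Wylie 2009, Lemma 2.1; for the Ricci flow
the same reaction term is Hamilton 1982, Cor. 7.3 (`CoordRicciEvolution.lean`). The proof is the
classical one, on constant fields:

* `IsMetricOn.cov₂At_ricAt_sub_of_soliton` — **`(∇_W Ric)(Y,Z) − (∇_Y Ric)(W,Z) = Df(R(W,Y)Z)`**
  (`Ric = λG − Hess f`, `∇G = 0`, and the Ricci identity for the Hessian
  `CoordBochner.cov₂At_hessAt_comm`);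
* `IsMetricOn.cov₃At_cov₂At_ricAt_sub_of_soliton` — its covariant derivative
  `∇²Ric(X,A;Y,Z) − ∇²Ric(X,Y;A,Z) = Hess f(X, R(A,Y)Z) + Df((∇_X R)(A,Y)Z)`;
* contracting `X = b_k`, `A = b_l` against `g^{kl}`: the left side is `ΔRic(Y,Z)` minus
  `Σ g^{kl} ∇²Ric(b_k,Y;Z,b_l) = ½ Hess S(Y,Z) − Rm(Ric)(Y,Z) − Σ g^{ij} Ric(Z, R(bᵢ,Y)bⱼ)`
  (`CoordRicciEvolution.sum_ginv_cov₃At_cov₂At_ricAt'`, the covariant derivative of the contracted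
  Bianchi identity plus the Ricci identity); the right side is
  `λ Ric(Y,Z) − Rm(Ric)(Y,Z)` (`Hess f = λG − Ric`) plus the once-contracted second Bianchi identity
  `Σ g^{kl} Df((∇_{b_k} R)(b_l,Y)Z) = (∇_{∇f} Ric)(Z,Y) − (∇_Z Ric)(∇f,Y)`
  (`CoordCurvatureLaplacian.sum_ginv_apply_covRiemAt`);
* `IsMetricOn.hessAt_scalAt_of_soliton` — **`½ Hess S(Y,Z) = (∇_Y Ric)(∇f,Z) + Ric(♯Hess f(Y,·), Z)`**
  (differentiate `dS = 2 Ric(∇f, ·)`, `CoordShrinkerIdentities.fderiv_scalAt_of_soliton`), and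
  `Ric(♯Hess f(Y,·), Z) = λ Ric(Y,Z) − ⟨Ric(Y), Ric(Z)⟩`, `Σ g^{ij} Ric(Z, R(bᵢ,Y)bⱼ) = −⟨Ric(Y), Ric(Z)⟩`
  (`CoordRicciEvolution.sum_ginv_ricAt_riemAt`);
* the remaining first-order terms `(∇_Y Ric)(∇f, Z) − (∇_Z Ric)(∇f, Y) = Df(R(Y,Z)∇f) = G(R(Y,Z)∇f, ∇f) = 0`.

Everything is proved; no definition and no statement of `Prop` type is introduced.

## References

* O. Munteanu, J. Wang, *Structure at infinity for shrinking Ricci solitons*, arXiv:1606.01861,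
  §2 (p. 6). [MunteanuWang2016]
* M. Eminenti, G. La Nave, C. Mantegazza, *Ricci solitons: the equation point of view*,
  manuscripta math. 127 (2008), Prop. 2.1. [EminentiLanaveMantegazza2008]
* R. S. Hamilton, *The formation of singularities in the Ricci flow*, Surveys in Differential
  Geometry 2 (1995), §20. [Hamilton1995]
* B. O'Neill, *Semi-Riemannian geometry with applications to relativity*, 1983, Ch. 3,
  Prop. 3.36–3.37, Cor. 3.54. [ONeill1983]
-/

noncomputable section

set_option maxSynthPendingDepth 3

open Set Filter ContinuousLinearMap Module
open scoped Topology ContDiff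

namespace Literature.Geometry.Lorentzian

namespace MetricCoord

variable {E : Type*} [NormedAddCommGroup E] [NormedSpace ℝ E] [FiniteDimensional ℝ E]
  [CompleteSpace E] {G : E → E →L[ℝ] E →L[ℝ] ℝ} {V : Set E} {x : E} {f : E → ℝ} {lam : ℝ}

/-! ### `d^∇ Ric = R(·,·)∇f` on a soliton -/

/-- **`(∇_W Ric)(Y,Z) − (∇_Y Ric)(W,Z) = Df(R(W,Y)Z)` on a gradient Ricci soliton**
(`∇Ric = −∇Hess f` and the Ricci identity for the Hessian; Eminenti–La Nave–Mantegazza 2008,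
Prop. 2.1: `∇_i R_{jk} − ∇_j R_{ik} = −R_{ijkl} ∇^l f` in their conventions).
[cite: EminentiLanaveMantegazza2008, Prop. 2.1] [cite: MunteanuWang2016, §2 (p. 6)] -/
theorem IsMetricOn.cov₂At_ricAt_sub_of_soliton (hG : IsMetricOn G V) (hx : x ∈ V)
    (hf : ContDiffOn ℝ ∞ f V)
    (hsol : ∀ y ∈ V, ∀ v w, ricAt G y v w + hessAt G f y v w = lam * G y v w) (W Y Z : E) :
    cov₂At G (ricAt G) x W Y Z - cov₂At G (ricAt G) x Y W Z = fderiv ℝ f x (riemAt G x W Y Z) := by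
  have h := hG.cov₂At_hessAt_comm hx hf W Y Z
  rw [hG.cov₂At_ricAt_of_soliton hx hf hsol]
  simp only [FunLike.coe_neg, Pi.neg_apply]
  linarith

/-- `∇Ric` is symmetric in its last two slots (`Ric` is symmetric near `x`). [folklore] -/
theorem IsMetricOn.cov₂At_ricAt_symm (hG : IsMetricOn G V) (hx : x ∈ V) (W Y Z : E) :
    cov₂At G (ricAt G) x W Y Z = cov₂At G (ricAt G) x W Z Y :=
  cov₂At_symm (hG.differentiableAt_ricAt hx)
    ((hG.eventually_mem hx).mono fun _ hy v w ↦ hG.ricAt_comm hy v w) W Y Z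

/-! ### The covariant derivative of `d^∇ Ric = R(·,·)∇f` -/

/-- **`∇²Ric(X,A;Y,Z) − ∇²Ric(X,Y;A,Z) = Hess f(X, R(A,Y)Z) + Df((∇_X R)(A,Y)Z)`**: the covariant
derivative along the constant field `X` of `(∇_A Ric)(Y,Z) − (∇_Y Ric)(A,Z) = Df(R(A,Y)Z)`
(product rule; the Christoffel corrections of the two sides match by the same identity at `x`).
[cite: EminentiLanaveMantegazza2008, Prop. 2.1] -/
theorem IsMetricOn.cov₃At_cov₂At_ricAt_sub_of_soliton (hG : IsMetricOn G V) (hx : x ∈ V)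
    (hf : ContDiffOn ℝ ∞ f V)
    (hsol : ∀ y ∈ V, ∀ v w, ricAt G y v w + hessAt G f y v w = lam * G y v w) (X A Y Z : E) :
    cov₃At G (cov₂At G (ricAt G)) x X A Y Z - cov₃At G (cov₂At G (ricAt G)) x X Y A Z =
      hessAt G f x X (riemAt G x A Y Z) + fderiv ℝ f x (covRiemAt G x X A Y Z) := by
  set P := cov₂At G (ricAt G) with hP
  have hPd : DifferentiableAt ℝ P x := hG.differentiableAt_cov₂At hx (hG.contDiffAt_ricAt hx)
  have hfx : ContDiffAt ℝ ∞ f x := hf.contDiffAt (hG.mem_nhds hx)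
  have hDf : DifferentiableAt ℝ (fderiv ℝ f) x :=
    (hfx.fderiv_right (m := ∞) (by simp)).differentiableAt (by simp)
  have hRd : DifferentiableAt ℝ (fun y ↦ riemAt G y A Y Z) x :=
    differentiableAt_clm_apply_const (hG.differentiableAt_riemAt hx A Y) Z
  -- the identity at the points of `V`, and at `x` for the correction terms
  have hid : ∀ y ∈ V, ∀ W Y' Z', P y W Y' Z' - P y Y' W Z' = fderiv ℝ f y (riemAt G y W Y' Z') :=
    fun y hy W Y' Z' ↦ hG.cov₂At_ricAt_sub_of_soliton hy hf hsol W Y' Z'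
  -- the derivative of `y ↦ P y A Y Z − P y Y A Z = Df_y(R_y(A,Y)Z)` along `X`
  have hderiv : fderiv ℝ P x X A Y Z - fderiv ℝ P x X Y A Z =
      fderiv ℝ (fderiv ℝ f) x X (riemAt G x A Y Z)
        + fderiv ℝ f x (fderiv ℝ (fun y ↦ riemAt G y A Y) x X Z) := by
    have h1 : fderiv ℝ P x X A Y Z = fderiv ℝ (fun y ↦ P y A Y Z) x X := by
      rw [← fderiv_clm_apply_const hPd A X,
        ← fderiv_clm_apply_const (differentiableAt_clm_apply_const hPd A) Y X,
        ← fderiv_clm_apply_const (differentiableAt_clm_apply_const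
          (differentiableAt_clm_apply_const hPd A) Y) Z X]
    have h2 : fderiv ℝ P x X Y A Z = fderiv ℝ (fun y ↦ P y Y A Z) x X := by
      rw [← fderiv_clm_apply_const hPd Y X,
        ← fderiv_clm_apply_const (differentiableAt_clm_apply_const hPd Y) A X,
        ← fderiv_clm_apply_const (differentiableAt_clm_apply_const
          (differentiableAt_clm_apply_const hPd Y) A) Z X]
    have hd1 : DifferentiableAt ℝ (fun y ↦ P y A Y Z) x :=
      differentiableAt_clm_apply_const (differentiableAt_clm_apply_const
        (differentiableAt_clm_apply_const hPd A) Y) Z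
    have hd2 : DifferentiableAt ℝ (fun y ↦ P y Y A Z) x :=
      differentiableAt_clm_apply_const (differentiableAt_clm_apply_const
        (differentiableAt_clm_apply_const hPd Y) A) Z
    have heq : (fun y ↦ P y A Y Z - P y Y A Z) =ᶠ[𝓝 x]
        fun y ↦ fderiv ℝ f y (riemAt G y A Y Z) :=
      (hG.eventually_mem hx).mono fun y hy ↦ hid y hy A Y Z
    have hsub : fderiv ℝ (fun y ↦ P y A Y Z) x X - fderiv ℝ (fun y ↦ P y Y A Z) x X =
        fderiv ℝ (fun y ↦ P y A Y Z - P y Y A Z) x X := by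
      rw [fderiv_fun_sub hd1 hd2, FunLike.coe_sub, Pi.sub_apply]
    rw [h1, h2, hsub, heq.fderiv_eq, fderiv_clm_apply hDf hRd]
    simp only [FunLike.coe_add, Pi.add_apply, ContinuousLinearMap.comp_apply,
      ContinuousLinearMap.flip_apply, hG.fderiv_riemAt_apply hx]
    ring
  have hc1 := hid x hx (chrAt G x X A) Y Z
  have hc2 := hid x hx A (chrAt G x X Y) Z
  have hc3 := hid x hx A Y (chrAt G x X Z)
  simp only [cov₃At_apply, hessAt_apply, covRiemAt_apply, map_add, map_sub]
  linear_combination hderiv - hc1 - hc2 - hc3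

/-! ### `Hess S` on a soliton -/

/-- **`Hess S(Y,Z) = 2 (∇_Y Ric)(∇f, Z) + 2 Ric(♯ Hess f(Y,·), Z)` on a gradient Ricci soliton**:
differentiate `dS = 2 Ric(♯Df, ·)` (`fderiv_scalAt_of_soliton`) along `Y`, using
`∂_Y ♯Df = ♯Hess f(Y,·) − Γ_Y ♯Df` (`fderiv_sharpAt_fderiv_apply`).
[cite: MunteanuWang2016, §2 (p. 6)] [cite: EminentiLanaveMantegazza2008, Prop. 2.1] -/
theorem IsMetricOn.hessAt_scalAt_of_soliton (hG : IsMetricOn G V) (hx : x ∈ V)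
    (hf : ContDiffOn ℝ ∞ f V)
    (hsol : ∀ y ∈ V, ∀ v w, ricAt G y v w + hessAt G f y v w = lam * G y v w) (Y Z : E) :
    hessAt G (scalAt G) x Y Z =
      2 * cov₂At G (ricAt G) x Y (sharpAt G x (fderiv ℝ f x)) Z
        + 2 * ricAt G x (sharpAt G x (hessAt G f x Y)) Z := by
  set v : E → E := fun y ↦ sharpAt G y (fderiv ℝ f y) with hv
  have hSx : ContDiffAt ℝ ∞ (scalAt G) x := hG.contDiffAt_scalAt hx
  have hdS : DifferentiableAt ℝ (fderiv ℝ (scalAt G)) x :=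
    (hSx.fderiv_right (m := ∞) (by simp)).differentiableAt (by simp)
  have hfx : ContDiffAt ℝ ∞ f x := hf.contDiffAt (hG.mem_nhds hx)
  have hDf : DifferentiableAt ℝ (fderiv ℝ f) x :=
    (hfx.fderiv_right (m := ∞) (by simp)).differentiableAt (by simp)
  have hvd : DifferentiableAt ℝ v x := (hG.differentiableAt_sharpAt hx).clm_apply hDf
  have hRd := hG.differentiableAt_ricAt hx
  -- `∂_Y (dS(Z)) = ∂_Y (2 Ric(v, Z))`
  have h1 : fderiv ℝ (fderiv ℝ (scalAt G)) x Y Z = fderiv ℝ (fun y ↦ fderiv ℝ (scalAt G) y Z) x Y :=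
    (fderiv_clm_apply_const hdS Z Y).symm
  have heq : (fun y ↦ fderiv ℝ (scalAt G) y Z) =ᶠ[𝓝 x] fun y ↦ (2 : ℝ) * ricAt G y (v y) Z :=
    (hG.eventually_mem hx).mono fun y hy ↦ hG.fderiv_scalAt_of_soliton hy hf hsol Z
  have hF : DifferentiableAt ℝ (fun y ↦ ricAt G y (v y)) x := hRd.clm_apply hvd
  have h2 : fderiv ℝ (fun y ↦ (2 : ℝ) * ricAt G y (v y) Z) x Y =
      2 * (fderiv ℝ (ricAt G) x Y (v x) Z + ricAt G x (fderiv ℝ v x Y) Z) := by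
    have h3 : fderiv ℝ (fun y ↦ ricAt G y (v y) Z) x Y =
        fderiv ℝ (ricAt G) x Y (v x) Z + ricAt G x (fderiv ℝ v x Y) Z := by
      rw [fderiv_clm_apply_const hF Z Y, fderiv_clm_apply hRd hvd]
      simp only [FunLike.coe_add, Pi.add_apply, ContinuousLinearMap.comp_apply,
        ContinuousLinearMap.flip_apply]
      ring
    rw [show (fun y ↦ (2 : ℝ) * ricAt G y (v y) Z) = fun y ↦ (2 : ℝ) • ricAt G y (v y) Z from rfl,
      fderiv_fun_const_smul (differentiableAt_clm_apply_const hF Z), FunLike.coe_smul,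
      Pi.smul_apply, smul_eq_mul, h3]
  have hdv : fderiv ℝ v x Y = sharpAt G x (hessAt G f x Y) - chrAt G x Y (v x) :=
    hG.fderiv_sharpAt_fderiv_apply hx hf Y
  rw [hessAt_apply, h1, heq.fderiv_eq, h2, hdv, hG.fderiv_scalAt_of_soliton hx hf hsol,
    cov₂At_apply, map_sub, hG.chrAt_comm hx Y (v x)]
  simp only [hv, FunLike.coe_sub, Pi.sub_apply]
  ring

/-! ### Algebraic contractions -/

section Contractions

variable {ι : Type*} [Fintype ι] (b : Basis ι ℝ E)

omit [CompleteSpace E] in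
/-- `Ric(♯α, Z) = Σ_{kl} g^{kl} α(b_l) Ric(b_k, Z)`. [cite: ONeill1983, Ch. 3, p. 60] -/
theorem ricAt_sharpAt_eq_sum (α : E →L[ℝ] ℝ) (Z : E) :
    ricAt G x (sharpAt G x α) Z = ∑ k, ∑ l, ginv G b x k l * (α (b l) * ricAt G x (b k) Z) := by
  have hflip : ∀ u, ricAt G x u Z = (ricAt G x).flip Z u := fun u ↦ rfl
  rw [hflip, sharpAt_eq_sum b α, map_sum]
  refine Finset.sum_congr rfl fun k _ ↦ ?_
  rw [map_smul, smul_eq_mul, Finset.sum_mul, ← hflip]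
  refine Finset.sum_congr rfl fun l _ ↦ ?_
  ring

omit [CompleteSpace E] in
/-- `Σ_{kl} g^{kl} G(b_k, R(b_l,Y)Z) = Ric(Y,Z)` (the trace defining `Ric`). [cite: ONeill1983, Ch. 3, Lemma 3.52] -/
theorem IsMetricOn.sum_ginv_apply_riemAt_eq_ricAt (hG : IsMetricOn G V) (hx : x ∈ V) (Y Z : E) :
    ∑ k, ∑ l, ginv G b x k l * G x (b k) (riemAt G x (b l) Y Z) = ricAt G x Y Z := by
  have hi := hG.isInvertible x hx
  have hs := hG.symm x hx
  rw [ricAt_eq_sum_ginv b hi, Finset.sum_comm]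
  refine Finset.sum_congr rfl fun l _ ↦ Finset.sum_congr rfl fun k _ ↦ ?_
  rw [ginv_comm b hi hs k l, hs]

/-- `Σ_{kl} g^{kl} Ric(b_k, R(b_l,Y)Z) = Σ_{ij} g^{ij} Ric(R(bᵢ,Y)Z, bⱼ)` (`Ric` symmetric).
[cite: ONeill1983, Ch. 3, Lemma 3.52] -/
theorem IsMetricOn.sum_ginv_ricAt_riemAt_swap (hG : IsMetricOn G V) (hx : x ∈ V) (Y Z : E) :
    ∑ k, ∑ l, ginv G b x k l * ricAt G x (b k) (riemAt G x (b l) Y Z) =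
      ∑ i, ∑ j, ginv G b x i j * ricAt G x (riemAt G x (b i) Y Z) (b j) := by
  have hi := hG.isInvertible x hx
  have hs := hG.symm x hx
  rw [Finset.sum_comm]
  refine Finset.sum_congr rfl fun l _ ↦ Finset.sum_congr rfl fun k _ ↦ ?_
  rw [ginv_comm b hi hs k l, hG.ricAt_comm hx]

/-- `Ric(♯Ric(Y,·), Z) = Σ_{kl} g^{kl} Ric(Y,b_k) Ric(Z,b_l) = ⟨Ric(Y), Ric(Z)⟩`.
[cite: ONeill1983, Ch. 3, pp. 60–61] -/
theorem IsMetricOn.ricAt_sharpAt_ricAt (hG : IsMetricOn G V) (hx : x ∈ V) (Y Z : E) :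
    ricAt G x (sharpAt G x (ricAt G x Y)) Z =
      ∑ k, ∑ l, ginv G b x k l * (ricAt G x Y (b k) * ricAt G x Z (b l)) := by
  have hi := hG.isInvertible x hx
  have hs := hG.symm x hx
  rw [ricAt_sharpAt_eq_sum b, Finset.sum_comm]
  refine Finset.sum_congr rfl fun l _ ↦ Finset.sum_congr rfl fun k _ ↦ ?_
  rw [ginv_comm b hi hs k l, hG.ricAt_comm hx (b k) Z]

end Contractions

/-! ### `ΔRic = ∇_{∇f}Ric + 2λRic − 2Rm(Ric)` -/

/-- **Hamilton's identity `Δ_f Ric = 2λ Ric − 2 Rm(Ric)` for gradient Ricci solitons, in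
coordinates** (Munteanu–Wang 2016, §2 (p. 6): `Δ_f Ric = Ric − 2 Rm Ric` for `λ = ½`;
Eminenti–La Nave–Mantegazza 2008, Prop. 2.1; Petersen–Wylie 2009, Lemma 2.1). For metric
components with `Ric + Hess f = λG` on `V`, at `x ∈ V`, for all `Y, Z` and any basis `b`:
`ΔRic(Y,Z) = (∇_{♯Df} Ric)(Y,Z) + 2λ Ric(Y,Z) − 2 Σ_{ij} g^{ij} Ric(R(bᵢ,Y)Z, bⱼ)`, where
`ΔRic = tr_G ∇²Ric` is the rough Laplacian (`lapBilinAt`). See the module docstring for the proof.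
[cite: MunteanuWang2016, §2 (p. 6)] [cite: EminentiLanaveMantegazza2008, Prop. 2.1]
[cite: Hamilton1995, §20] -/
theorem IsMetricOn.lapBilinAt_ricAt_of_soliton {ι : Type*} [Fintype ι] (b : Basis ι ℝ E)
    (hG : IsMetricOn G V) (hx : x ∈ V) (hf : ContDiffOn ℝ ∞ f V)
    (hsol : ∀ y ∈ V, ∀ v w, ricAt G y v w + hessAt G f y v w = lam * G y v w) (Y Z : E) :
    lapBilinAt G (ricAt G) x Y Z =
      cov₂At G (ricAt G) x (sharpAt G x (fderiv ℝ f x)) Y Z + 2 * lam * ricAt G x Y Z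
        - 2 * ∑ i, ∑ j, ginv G b x i j * ricAt G x (riemAt G x (b i) Y Z) (b j) := by
  have hi := hG.isInvertible x hx
  have hs := hG.symm x hx
  set v : E := sharpAt G x (fderiv ℝ f x) with hv
  set P := cov₂At G (ricAt G) with hP
  -- (1) contract the differentiated identity
  have hA : ∀ k l, cov₃At G P x (b k) (b l) Y Z =
      cov₃At G P x (b k) Y Z (b l) + hessAt G f x (b k) (riemAt G x (b l) Y Z)
        + fderiv ℝ f x (covRiemAt G x (b k) (b l) Y Z) := by
    intro k l
    have h := hG.cov₃At_cov₂At_ricAt_sub_of_soliton hx hf hsol (b k) (b l) Y Z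
    rw [hG.cov₃At_cov₂At_ricAt_symm hx (b k) Y (b l) Z] at h
    linarith
  have hlap : lapBilinAt G (ricAt G) x Y Z = ∑ k, ∑ l, ginv G b x k l * cov₃At G P x (b k) (b l) Y Z :=
    lapBilinAt_apply_eq_sum G (ricAt G) b x Y Z
  -- (2) the four contracted sums
  have hT2 := hG.sum_ginv_cov₃At_cov₂At_ricAt' b hx Y Z
  have hH : ∀ u w, hessAt G f x u w = lam * G x u w - ricAt G x u w := by
    intro u w
    have h := hsol x hx u w
    linarith
  have hT3 : ∑ k, ∑ l, ginv G b x k l * hessAt G f x (b k) (riemAt G x (b l) Y Z) =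
      lam * ricAt G x Y Z - ∑ i, ∑ j, ginv G b x i j * ricAt G x (riemAt G x (b i) Y Z) (b j) := by
    simp only [hH, mul_sub, Finset.sum_sub_distrib]
    rw [← hG.sum_ginv_ricAt_riemAt_swap b hx Y Z, ← hG.sum_ginv_apply_riemAt_eq_ricAt b hx Y Z,
      Finset.mul_sum]
    congr 1
    refine Finset.sum_congr rfl fun k _ ↦ ?_
    rw [Finset.mul_sum]
    refine Finset.sum_congr rfl fun l _ ↦ ?_
    ring
  have hT4 : ∑ k, ∑ l, ginv G b x k l * fderiv ℝ f x (covRiemAt G x (b k) (b l) Y Z) =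
      -(P x Z v Y - P x v Z Y) := by
    rw [← hG.sum_ginv_apply_covRiemAt b hx Y Z v, ← Finset.sum_neg_distrib]
    refine Finset.sum_congr rfl fun k _ ↦ ?_
    rw [← Finset.sum_neg_distrib]
    refine Finset.sum_congr rfl fun l _ ↦ ?_
    have h1 : fderiv ℝ f x (covRiemAt G x (b k) (b l) Y Z) =
        -(G x (covRiemAt G x (b k) Y (b l) Z) v) := by
      rw [covRiemAt_swap x (b k) Y (b l), FunLike.coe_neg, Pi.neg_apply, map_neg, hs _ v, hv,
        apply_sharpAt_apply hi]
    rw [h1, mul_neg]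
  -- (3) `½ Hess S` and the quadratic Ricci terms
  have hHS := hG.hessAt_scalAt_of_soliton hx hf hsol Y Z
  have hsharp : sharpAt G x (hessAt G f x Y) = lam • Y - sharpAt G x (ricAt G x Y) := by
    have hform : hessAt G f x Y = lam • G x Y - ricAt G x Y := by
      ext w
      simp only [FunLike.coe_sub, Pi.sub_apply, FunLike.coe_smul, Pi.smul_apply, smul_eq_mul]
      exact hH Y w
    rw [hform, map_sub, map_smul, sharpAt_apply hi]
  have hQ1 := hG.ricAt_sharpAt_ricAt b hx Y Z
  have hQ2 := hG.sum_ginv_ricAt_riemAt b hx Y Z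
  -- (4) the first-order terms cancel: `P(Y,v,Z) − P(Z,v,Y) = Df(R(Y,Z)v) = 0`
  have hfirst : P x Y v Z - P x Z v Y = 0 := by
    rw [hG.cov₂At_ricAt_symm hx Y v Z, hG.cov₂At_ricAt_symm hx Z v Y,
      hG.cov₂At_ricAt_sub_of_soliton hx hf hsol Y Z v, ← apply_sharpAt_apply hi (fderiv ℝ f x),
      ← hv, hs]
    have h0 := hG.apply_riemAt_swap hx Y Z v v
    linarith
  have hsymv : P x v Z Y = P x v Y Z := hG.cov₂At_ricAt_symm hx v Z Y
  -- (5) assemble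
  rw [hlap]
  have hsum : ∑ k, ∑ l, ginv G b x k l * cov₃At G P x (b k) (b l) Y Z =
      ∑ k, ∑ l, ginv G b x k l * cov₃At G P x (b k) Y Z (b l)
        + ∑ k, ∑ l, ginv G b x k l * hessAt G f x (b k) (riemAt G x (b l) Y Z)
        + ∑ k, ∑ l, ginv G b x k l * fderiv ℝ f x (covRiemAt G x (b k) (b l) Y Z) := by
    simp only [hA, mul_add, Finset.sum_add_distrib]
  rw [hsum, hT2, hT3, hT4, hHS, hsharp, map_sub, map_smul, FunLike.coe_sub, Pi.sub_apply,
    FunLike.coe_smul, Pi.smul_apply, smul_eq_mul, hQ1, hQ2]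
  linear_combination hfirst + hsymv

end MetricCoord

end Literature.Geometry.Lorentzian

end
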